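import Mathlib
import HarnessLib

/-!
# Route `PoloidalWindowDoor`, crux `PoloidalWindowRigidity` (K2, stmt-NavierStokesRegularity-19708), skeleton `lrc-jet` v5,
# stub `stub_untwisted` — brick F5c: SMOOTH LOCALIZATION OF A ONE-VARIABLE FUNCTION

Cell ns-regularity-ideate, K2 lead ns-poloidal-K2-p1 (gen 6; `--supports stmt-NavierStokesRegularity-19708`, helper; BRIEF-v5-bricks-v2 (S2)/(S5)).
The slice form of the Levi-Civita–Segre theorem used by the endgame (`…UntwistedSliceGlue.circles_or_lines_of_isoparametric_slice`,
`…UntwistedEndgame.regular_of_isoparametric_base`) asks for GLOBALLY `C²` / `C¹` isoparametric functions `a, b : ℝ → ℝ`, while the separation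
bricks F3a/F3b produce them as rational expressions in the structure jets, smooth only near the value `w(y₁)`.  This file bridges the gap:
a function that is `Cⁿ` at every point of a neighbourhood of `ω₀` agrees near `ω₀` with a globally `Cⁿ` function (bump-function cut-off),
together with its derivative.

* `exists_contDiff_eventuallyEq` — the statement above.

WHAT THIS IS NOT: not a claim about Navier–Stokes — calculus bookkeeping (bears_on LADDER-NS N0 via crux K2 = stmt-19708).
-/

noncomputable section

-- the summit and its single sub-problem share the name (CONVENTIONS §1), as in every Theorems file
set_option linter.dupNamespace false

namespace Summit.NavierStokesRegularity.NavierStokesRegularity.Theorems.PoloidalWindowDoorPoloidalWindowRigidityUntwistedLocalization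

open Set Function Filter Topology Metric

/-- **Smooth localization.**  If `a : ℝ → ℝ` is `Cⁿ` at every point near `ω₀`, there is a globally `Cⁿ` function `ã` with `ã = a` near `ω₀`
(hence also `deriv ã = deriv a` near `ω₀`). [folklore] -/
theorem exists_contDiff_eventuallyEq {a : ℝ → ℝ} {ω₀ : ℝ} {n : ℕ∞} (h : ∀ᶠ ω in 𝓝 ω₀, ContDiffAt ℝ n a ω) :
    ∃ g : ℝ → ℝ, ContDiff ℝ n g ∧ g =ᶠ[𝓝 ω₀] a ∧ deriv g =ᶠ[𝓝 ω₀] deriv a := by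
  obtain ⟨ε, hε, hball⟩ := Metric.eventually_nhds_iff_ball.mp h
  -- a bump function equal to `1` on `closedBall ω₀ (ε/4)` and supported in `closedBall ω₀ (ε/2)`
  let χ : ContDiffBump ω₀ := ⟨ε / 4, ε / 2, by positivity, by linarith⟩
  refine ⟨fun ω => χ ω * a ω, ?_, ?_, ?_⟩
  · rw [contDiff_iff_contDiffAt]
    intro ω
    by_cases hω : ω ∈ ball ω₀ ε
    · exact (χ.contDiff.contDiffAt).mul (hball ω hω)
    · -- outside the support of `χ` the product vanishes identically near `ω`
      have hnot : ω ∉ tsupport (χ : ℝ → ℝ) := by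
        rw [χ.tsupport_eq]
        intro hmem
        apply hω
        have h1 : dist ω ω₀ ≤ ε / 2 := mem_closedBall.mp hmem
        exact mem_ball.mpr (by linarith)
      have hzero : (χ : ℝ → ℝ) =ᶠ[𝓝 ω] 0 := notMem_tsupport_iff_eventuallyEq.mp hnot
      have hprod : (fun ω' => χ ω' * a ω') =ᶠ[𝓝 ω] fun _ => (0 : ℝ) := by
        filter_upwards [hzero] with ω' hω'
        rw [hω', Pi.zero_apply, zero_mul]
      exact (contDiffAt_const.congr_of_eventuallyEq hprod)
  · have hone : ∀ᶠ ω in 𝓝 ω₀, χ ω = 1 := by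
      filter_upwards [Metric.closedBall_mem_nhds ω₀ (show (0 : ℝ) < ε / 4 by positivity)] with ω hω
      exact χ.one_of_mem_closedBall hω
    filter_upwards [hone] with ω hω
    rw [hω, one_mul]
  · have hone : ∀ᶠ ω in 𝓝 ω₀, χ ω = 1 := by
      filter_upwards [Metric.closedBall_mem_nhds ω₀ (show (0 : ℝ) < ε / 4 by positivity)] with ω hω
      exact χ.one_of_mem_closedBall hω
    have heq : (fun ω => χ ω * a ω) =ᶠ[𝓝 ω₀] a := by
      filter_upwards [hone] with ω hω
      rw [hω, one_mul]
    -- eventual equality of functions near `ω₀` gives eventual equality of derivatives near `ω₀`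
    obtain ⟨U, hU, hUo, hω₀U⟩ := _root_.mem_nhds_iff.mp heq
    filter_upwards [hUo.mem_nhds hω₀U] with ω hω
    have hloc : (fun ω => χ ω * a ω) =ᶠ[𝓝 ω] a := Filter.eventually_of_mem (hUo.mem_nhds hω) fun ω' hω' => hU hω'
    exact hloc.deriv_eq

end Summit.NavierStokesRegularity.NavierStokesRegularity.Theorems.PoloidalWindowDoorPoloidalWindowRigidityUntwistedLocalization

end
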